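import Summits.HodgeConjecture.HodgeConjecture.Theorems.VHCAbelianSchemesRoadIsogenyTwistIotaCompat
import Summits.HodgeConjecture.HodgeConjecture.Theorems.VHCAbelianSchemesRoadTracePushforwardCompatOfBricks
import Literature.AlgebraicGeometry.Modules.PushforwardTrace
import HarnessLib

/-!
# Road №4 (`VHCAbelianSchemesRoad`) — the trace on `q`-forms `Θ_q(g) : g_*Ω^q_A ⟶ Ω^q_A` of an isogeny in the free-cotangent model, and
# `g^♯ ≫ Θ_q = deg g · 𝟙` (the module-level half of (G1) for core-w1's Gysin map `ρ_q`; crux stmt-HodgeConjecture-26512)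

research route conditional on HC_CM; not a corollary; Q11.4-sentence-2 already refuted in dim ≥ 3.

Seat core-w6 (width copy of core-D; director-hodge g16 R16.24 (3) «Θ_q for w1», R16.25 (4) «then (P3) the projection-formula identity for Θ_q»;
core-w1 l.5667 (iii)). `--supports stmt-HodgeConjecture-26512 --as helper`; closes NO stub; CONDITIONAL on the named fact «`Ω¹_A` free»
(`hΩ : Mumford1970_cotangentSheaf_abelianVariety_free`) only (and, where stated, on the framing hypothesis `hn` of the Literature trace
`algebraUnit_comp_pushforwardTrace` = «`g_*𝒪_A` framed of cardinality `n = deg g` near every point», a hypothesis displayed verbatim); nothing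
here says (G1), (TrPair), (c1Tr), (c1), T′, `HC_AV`, `HC_CM` or HC holds; HC_CM HELD, by name only; typed ≠ proved.

THE DATUM. In the free-cotangent model of α₀ (p650171: global frame `hodgeSheafFrame hΩ A q : Ω^q_A ≅ ∏ᶜ_{Fin N} 𝒪_A`, `dg`-twist
`θ_q(g) = isogenyFormsTwist hΩ A g q`, with `θ_q(g)⁻¹ω_I = g^♯ω_I`, p654817) the trace on `q`-forms is FORCED by the projection formula
`g_*g^*Ω^q ≅ Ω^q ⊗ g_*𝒪` and `dg_q : g^*Ω^q ≅ Ω^q` (p652022): a section `s = Σ_J u_J · g^♯ω_J` of `g_*Ω^q_A` (`u_J ∈ g_*𝒪_A`, the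
coordinates of `θ_q(g) s` in the frame) must go to `Σ_J Trace_g(u_J) · ω_J`. Hence
* `isogenyFormsTrace hΩ A g h q := g_*(θ_q(g) ≫ frame) ≫ (Trace_g ∘ g_*π_K)_K ≫ frame⁻¹ : g_*Ω^q_A ⟶ Ω^q_A` (`Trace_g = pushforwardTrace`, [StacksProject 0BVH],
  `h` = «`g_*𝒪_A` finite locally free», e.g. `isogenyPushforwardFiniteLocallyFree_holds`), with its frame components
  `isogenyFormsTrace_comp_frame_π` — this IS the projection-formula identity (P3) in the model (the model's projection formula is coordinatewise);
* **`comap_comp_isogenyFormsTrace` : `g^♯_q ≫ Θ_q(g) = n • 𝟙_{Ω^q}`** under the framing hypothesis `hn` of `algebraUnit_comp_pushforwardTrace`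
  (`n = deg g`) — from p653206's `comap_comp_map_formsTwist_frameCoord` (`g^♯ ≫ g_*(θ ≫ coord_K) = coord_K ≫ g♯`) and `g♯ ≫ Trace_g = n`;
  this is the module-level content of (G1) `ρ_q ∘ g^♮ = deg g · id`;
* `isogenyFormsTraceSingle` — the same as a cochain map `g_*•(Ω^q_A[0]) ⟶ Ω^q_A[0]` (the type of the field `Θ` of core-w1∕w2's
  `TracePushforwardBricks`), via Mathlib's `singleMapHomologicalComplex`; `hodgeComapSingle` — `g^♯` as a cochain map the other way; and
  **`hodgeComapSingle_comp_isogenyFormsTraceSingle` : `g^♯• ≫ Θ• = n • 𝟙`**.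

References: [cite: StacksProject, Tag 0BVH (trace of a finite locally free morphism; `Trace ∘ π♯ = deg`)] [cite: Hartshorne1977, II Ex. 5.1, III Prop. 10.4, III Ex. 6.10 (trace ∕ projection formula for finite flat maps)]
[cite: MumfordAV1970, §4 (iii) (p. 42)] [cite: BuchweitzFlenner2003, Def. 4.1].
-/

noncomputable section

-- `TopCat.Presheaf`/`Scheme.Modules` are not reducible (as in Mathlib's `AlgebraicGeometry/Modules/Sheaf.lean`).
set_option backward.isDefEq.respectTransparency false

open CategoryTheory CategoryTheory.Limits AlgebraicGeometry Opposite TopologicalSpace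
open AlgebraicGeometry.Scheme.Modules

namespace Summit.HodgeConjecture.HodgeConjecture.Ring2.SemiregularRepresentatives

set_option linter.dupNamespace false -- the cell's namespace repeats the summit name, as in every `Ring2*` file

open Literature.AlgebraicGeometry Literature.AlgebraicGeometry.Modules Literature.AlgebraicGeometry.Motives
open Literature.AlgebraicGeometry.Motives.AbelianVariety Literature.AlgebraicGeometry.HodgeTheory

universe u

/-! ## §1 The two spellings of `f♯ : 𝒪_Y ⟶ f_*𝒪_X` agree -/

/-- The tree's two spellings of the algebra unit `f♯ : 𝒪_Y ⟶ f_*𝒪_X` (`Modules/PushforwardTrace.algebraUnit`,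
`Modules/PushforwardIsoUnit.unitPushforwardHom`) agree. [cite: StacksProject, Tag 0BVH] -/
theorem algebraUnit_eq_unitPushforwardHom {X Y : Scheme.{u}} (f : X ⟶ Y) : algebraUnit f = unitPushforwardHom f := by
  refine Scheme.Modules.hom_ext _ _ fun U => ?_
  ext a
  rw [algebraUnit_app_apply, unitPushforwardHom_app_apply]

/-! ## §2 The trace on `q`-forms `Θ_q(g)` -/

section FormsTrace

/-- **The trace on `q`-forms of an isogeny, `Θ_q(g) : g_*Ω^q_A ⟶ Ω^q_A`**, in the free-cotangent model: move by the `dg`-twist `θ_q(g)`,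
take frame coordinates, apply `Trace_g : g_*𝒪_A → 𝒪_A` coordinatewise, leave the frame: `s ↦ Σ_K Trace_g(coord_K(θ_q(g) s)) · ω_K`
(= `Σ_J Trace_g(u_J) · ω_J` for `s = Σ_J u_J · g^♯ω_J`, the projection formula). CONDITIONAL on `hΩ`.
[cite: StacksProject, Tag 0BVH] [cite: Hartshorne1977, III Ex. 6.10 (reading: trace for a finite flat morphism)] -/
def isogenyFormsTrace (hΩ : Mumford1970_cotangentSheaf_abelianVariety_free) (A : AbelianVariety ℂ) (g : A ⟶ A)
    (h : IsFiniteLocallyFree ((pushforward (Hom.toSchemeHom g)).obj (unitModule A.X.left))) (q : ℕ) :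
    (pushforward (Hom.toSchemeHom g)).obj (hodgeSheaf A.X q) ⟶ hodgeSheaf A.X q :=
  (pushforward (Hom.toSchemeHom g)).map ((isogenyFormsTwist hΩ A g q).hom ≫ (hodgeSheafFrame hΩ A q).hom) ≫
    Limits.Pi.lift (fun K : Fin (A.dim.choose q) =>
      (pushforward (Hom.toSchemeHom g)).map (Limits.Pi.π _ K) ≫ pushforwardTrace (Hom.toSchemeHom g) h) ≫
      (hodgeSheafFrame hΩ A q).inv

/-- **Frame components of `Θ_q(g)` — the projection-formula identity (P3) in the model**:
`Θ_q ≫ coord_K = g_*(θ_q(g) ≫ coord_K) ≫ Trace_g`. CONDITIONAL on `hΩ`. [cite: StacksProject, Tag 0BVH] [cite: Hartshorne1977, III Ex. 6.10] -/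
theorem isogenyFormsTrace_comp_frame_π (hΩ : Mumford1970_cotangentSheaf_abelianVariety_free) (A : AbelianVariety ℂ) (g : A ⟶ A)
    (h : IsFiniteLocallyFree ((pushforward (Hom.toSchemeHom g)).obj (unitModule A.X.left))) (q : ℕ) (K : Fin (A.dim.choose q)) :
    isogenyFormsTrace hΩ A g h q ≫ (hodgeSheafFrame hΩ A q).hom ≫ Limits.Pi.π _ K =
      (pushforward (Hom.toSchemeHom g)).map
          ((isogenyFormsTwist hΩ A g q).hom ≫ ((hodgeSheafFrame hΩ A q).hom ≫ Limits.Pi.π _ K)) ≫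
        pushforwardTrace (Hom.toSchemeHom g) h := by
  rw [isogenyFormsTrace, Category.assoc, Category.assoc, Iso.inv_hom_id_assoc, Limits.Pi.lift_π, ← Category.assoc,
    ← Functor.map_comp, Category.assoc]

/-- Sections of `Θ_q(g)` in frame coordinates: `coord_K(Θ_q s) = Trace_g(coord_K(θ_q(g) s))`. CONDITIONAL on `hΩ`.
[cite: StacksProject, Tag 0BVH] [cite: Hartshorne1977, III Ex. 6.10] -/
theorem frame_π_app_isogenyFormsTrace_app (hΩ : Mumford1970_cotangentSheaf_abelianVariety_free) (A : AbelianVariety ℂ) (g : A ⟶ A)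
    (h : IsFiniteLocallyFree ((pushforward (Hom.toSchemeHom g)).obj (unitModule A.X.left))) (q : ℕ) (K : Fin (A.dim.choose q))
    (U : A.X.left.Opens) (s : Γ((pushforward (Hom.toSchemeHom g)).obj (hodgeSheaf A.X q), U)) :
    ((hodgeSheafFrame hΩ A q).hom ≫ Limits.Pi.π _ K).app U ((isogenyFormsTrace hΩ A g h q).app U s) =
      (pushforwardTrace (Hom.toSchemeHom g) h).app U (((pushforward (Hom.toSchemeHom g)).map
        ((isogenyFormsTwist hΩ A g q).hom ≫ ((hodgeSheafFrame hΩ A q).hom ≫ Limits.Pi.π _ K))).app U s) := by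
  change (isogenyFormsTrace hΩ A g h q ≫ (hodgeSheafFrame hΩ A q).hom ≫ Limits.Pi.π _ K).app U s = _
  rw [isogenyFormsTrace_comp_frame_π]
  rfl

/-- **`g^♯_q ≫ Θ_q(g) = deg g · 𝟙_{Ω^q_A}`** — the module-level content of the split identity (G1) `ρ_q ∘ g^♮ = deg g · id` for core-w1's
Gysin map: pulled-back forms have pulled-back frame coordinates after the `dg`-twist (`comap_comp_map_formsTwist_frameCoord`, p653206) and
`g♯ ≫ Trace_g = n · 𝟙` (`algebraUnit_comp_pushforwardTrace`, whose framing hypothesis `hn` — `g_*𝒪_A` framed of cardinality `n` near every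
point — is displayed verbatim). CONDITIONAL on `hΩ` and `hn`. [cite: StacksProject, Tag 0BVH] [cite: Hartshorne1977, III Prop. 10.4] -/
theorem comap_comp_isogenyFormsTrace (hΩ : Mumford1970_cotangentSheaf_abelianVariety_free) (A : AbelianVariety ℂ) (g : A ⟶ A)
    (hg : IsIsogeny g) (h : IsFiniteLocallyFree ((pushforward (Hom.toSchemeHom g)).obj (unitModule A.X.left))) (q : ℕ) (n : ℕ)
    (hn : ∀ y : A.X.left, ∃ (V : A.X.left.Opens) (_ : y ∈ V) (I : Type) (_ : Fintype I)
      (_ : SheafOfModules.free I ≅ ((pushforward (Hom.toSchemeHom g)).obj (unitModule A.X.left)).over V), Fintype.card I = n) :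
    hodgeSheaf.comap g.hom.hom.hom q ≫ isogenyFormsTrace hΩ A g h q = n • 𝟙 (hodgeSheaf A.X q) := by
  rw [← cancel_mono (hodgeSheafFrame hΩ A q).hom]
  refine Limits.Pi.hom_ext _ _ fun K => ?_
  rw [Category.assoc, Category.assoc, Category.assoc, isogenyFormsTrace_comp_frame_π, ← Category.assoc,
    comap_comp_map_formsTwist_frameCoord hΩ A g q hg K, Category.assoc, ← algebraUnit_eq_unitPushforwardHom,
    algebraUnit_comp_pushforwardTrace (Hom.toSchemeHom g) h n hn]
  simp only [Preadditive.comp_nsmul, Preadditive.nsmul_comp, Category.comp_id, Category.id_comp]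

end FormsTrace

/-! ## §3 As cochain maps on `Ω^q_A[0]` (the type of `TracePushforwardBricks.Θ`) -/

section Single

/-- **`Θ_q(g)` as a cochain map `g_*•(Ω^q_A[0]) ⟶ Ω^q_A[0]`** (the type of the field `Θ` of `TracePushforwardBricks`): single complexes
commute with `g_*•` (`singleMapHomologicalComplex`), then `Θ_q(g)[0]`. CONDITIONAL on `hΩ`. [cite: BuchweitzFlenner2003, Def. 4.1] [cite: StacksProject, Tag 0BVH] -/
def isogenyFormsTraceSingle (hΩ : Mumford1970_cotangentSheaf_abelianVariety_free) (A : AbelianVariety ℂ) (g : A ⟶ A)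
    (h : IsFiniteLocallyFree ((pushforward (Hom.toSchemeHom g)).obj (unitModule A.X.left))) (q : ℕ) :
    endoPushforwardComplex A g (hodgeSingle A q) ⟶ hodgeSingle A q :=
  ((HomologicalComplex.singleMapHomologicalComplex (pushforward (Hom.toSchemeHom g)) (ComplexShape.up ℤ) 0).app
      (hodgeSheaf A.X q)).hom ≫
    (HomologicalComplex.single A.X.left.Modules (ComplexShape.up ℤ) 0).map (isogenyFormsTrace hΩ A g h q)

/-- **`g^♯_q` as a cochain map `Ω^q_A[0] ⟶ g_*•(Ω^q_A[0])`** (`hodgeSheaf.comap` on the single complexes). [cite: Hartshorne1977, II Prop. 8.11] -/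
def hodgeComapSingle (A : AbelianVariety ℂ) (g : A ⟶ A) (q : ℕ) : hodgeSingle A q ⟶ endoPushforwardComplex A g (hodgeSingle A q) :=
  (HomologicalComplex.single A.X.left.Modules (ComplexShape.up ℤ) 0).map (hodgeSheaf.comap g.hom.hom.hom q) ≫
    ((HomologicalComplex.singleMapHomologicalComplex (pushforward (Hom.toSchemeHom g)) (ComplexShape.up ℤ) 0).app
      (hodgeSheaf A.X q)).inv

/-- **`g^♯• ≫ Θ• = deg g · 𝟙` on `Ω^q_A[0]`** (from `comap_comp_isogenyFormsTrace`). CONDITIONAL on `hΩ` and `hn`.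
[cite: StacksProject, Tag 0BVH] [cite: BuchweitzFlenner2003, Def. 4.1] -/
theorem hodgeComapSingle_comp_isogenyFormsTraceSingle (hΩ : Mumford1970_cotangentSheaf_abelianVariety_free) (A : AbelianVariety ℂ)
    (g : A ⟶ A) (hg : IsIsogeny g) (h : IsFiniteLocallyFree ((pushforward (Hom.toSchemeHom g)).obj (unitModule A.X.left))) (q : ℕ)
    (n : ℕ) (hn : ∀ y : A.X.left, ∃ (V : A.X.left.Opens) (_ : y ∈ V) (I : Type) (_ : Fintype I)
      (_ : SheafOfModules.free I ≅ ((pushforward (Hom.toSchemeHom g)).obj (unitModule A.X.left)).over V), Fintype.card I = n) :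
    hodgeComapSingle A g q ≫ isogenyFormsTraceSingle hΩ A g h q = n • 𝟙 (hodgeSingle A q) := by
  rw [hodgeComapSingle, isogenyFormsTraceSingle, Category.assoc, Iso.inv_hom_id_assoc, ← Functor.map_comp,
    comap_comp_isogenyFormsTrace hΩ A g hg h q n hn, Functor.map_nsmul, CategoryTheory.Functor.map_id]

end Single

end Summit.HodgeConjecture.HodgeConjecture.Ring2.SemiregularRepresentatives

end
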